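import Summits.CriticalPhenomena.PercolationContinuityZ3.Theorems.PercNearOneGluingNoHeavyLowerTailIncStarTwoCutNearPos
import HarnessLib

/-!
# Two-cuts with the root and one target on the root side (MODE B), VIII: the near lemma — the `XY` row

Support file for the Sahi programme (`--supports stmt-CriticalPhenomena-4575`, prover prim-sahi-p2 gen 26).  No definitions, no named
facts, no sorries; standard axioms.  Memo `run/shared/lean/prim/prim-sahi/FROM-prim-sahi-p2-gen26-NEAR-LEMMA.md` §2 ((N3″)).

With `Sep = {s, x, y pairwise separated}`, `Ŵ = {s ↔ x} ∩ {s ↔ y}` (all three joined), `D_x = {x↮s} ∩ {x↮y}`, `E_x = D_x ∩ {x↔a}` (and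
mirrors), the tree instances of part IV (`near_sepSum_three`, `near_alone_le_allSep`) give the `XY` row of the near lemma in product form
(`near_row_XY`):  `μ(Ŵ) · (μ(E_x)·μ(D_y) + μ(E_y)·μ(D_x)) ≤ μ(D_x) · μ(D_y) · μ(Ŵ ∩ {s↔a})`  whenever `μ(Sep) > 0`,
i.e. `P(a ∈ C_s | s↔x, s↔y) ≥ τ_x + τ_y` (memo (N3″); the θ-version (N3) follows from `θ ≤ τ`, part IV).
-/

noncomputable section

namespace Summit.CriticalPhenomena.PercolationContinuityZ3.Theorems

namespace IncStarTwoCut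

open MeasureTheory Set Literature.Probability.Percolation Literature.Probability.LatticeModels
open scoped Classical

variable {V : Type} [Fintype V]

section Sets
omit [Fintype V]

/-- The pairwise-separation event of the port set `{s,x,y}` (distinct) in plain form. [folklore] -/
theorem sep_eq {s x y : V} (hsx : s ≠ x) (hsy : s ≠ y) (hxy : x ≠ y) :
    {ω : BondConfig V | ∀ u ∈ ({s, x, y} : Finset V), ∀ v ∈ ({s, x, y} : Finset V), u ≠ v → ¬ (openGraph ω).Reachable u v}
      = (openConn s x)ᶜ ∩ (openConn s y)ᶜ ∩ (openConn x y)ᶜ := by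
  ext ω
  simp only [mem_setOf_eq, Finset.mem_insert, Finset.mem_singleton, mem_inter_iff, mem_compl_iff, openConn]
  constructor
  · intro h
    exact ⟨⟨h s (Or.inl rfl) x (Or.inr (Or.inl rfl)) hsx, h s (Or.inl rfl) y (Or.inr (Or.inr rfl)) hsy⟩,
      h x (Or.inr (Or.inl rfl)) y (Or.inr (Or.inr rfl)) hxy⟩
  · rintro ⟨⟨h1, h2⟩, h3⟩ u hu v hv huv
    have hs : ∀ {p q : V}, ¬ (openGraph ω).Reachable p q → ¬ (openGraph ω).Reachable q p := fun h h' => h h'.symm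
    rcases hu with hu | hu | hu <;> rcases hv with hv | hv | hv <;> rw [hu, hv] at huv ⊢ <;>
      first | exact absurd rfl huv | exact h1 | exact h2 | exact h3 | exact hs h1 | exact hs h2 | exact hs h3

/-- The all-glued event of the port set `{s,x,y}` in plain form. [folklore] -/
theorem glued_eq (s x y : V) :
    {ω : BondConfig V | ∀ u ∈ ({s, x, y} : Finset V), ∀ v ∈ ({s, x, y} : Finset V), (openGraph ω).Reachable u v}
      = openConn s x ∩ openConn s y := by
  ext ω
  simp only [mem_setOf_eq, Finset.mem_insert, Finset.mem_singleton, mem_inter_iff, openConn]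
  constructor
  · intro h; exact ⟨h s (Or.inl rfl) x (Or.inr (Or.inl rfl)), h s (Or.inl rfl) y (Or.inr (Or.inr rfl))⟩
  · rintro ⟨h1, h2⟩ u hu v hv
    have h12 : (openGraph ω).Reachable x y := h1.symm.trans h2
    rcases hu with hu | hu | hu <;> rcases hv with hv | hv | hv <;> rw [hu, hv] <;>
      first | exact SimpleGraph.Reachable.refl _ | exact h1 | exact h2 | exact h1.symm | exact h2.symm | exact h12 | exact h12.symm

/-- The "`x` alone" event of the port set `{s,x,y}` in plain form. [folklore] -/
theorem aloneFin_eq {s x y : V} (hsx : s ≠ x) (hxy : x ≠ y) :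
    {ω : BondConfig V | ∀ z ∈ (↑({s, x, y} : Finset V) : Set V) \ {x}, ¬ (openGraph ω).Reachable x z}
      = (openConn x s)ᶜ ∩ (openConn x y)ᶜ := by
  ext ω
  simp only [mem_setOf_eq, mem_sdiff, Finset.coe_insert, Finset.coe_singleton, mem_insert_iff, mem_singleton_iff, mem_inter_iff,
    mem_compl_iff, openConn]
  constructor
  · intro h
    exact ⟨h s ⟨Or.inl rfl, hsx⟩, h y ⟨Or.inr (Or.inr rfl), fun e => hxy e.symm⟩⟩
  · rintro ⟨h1, h2⟩ z ⟨hz, hzx⟩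
    rcases hz with hz | hz | hz <;> rw [hz] at hzx ⊢
    · exact h1
    · exact absurd rfl hzx
    · exact h2

end Sets

/-- **The `XY` row of the near lemma** (memo (N3″)): for distinct `s, x, y` with `μ(Sep) > 0`,
`μ(Ŵ)·(μ(E_x)μ(D_y) + μ(E_y)μ(D_x)) ≤ μ(D_x)μ(D_y)μ(Ŵ ∩ {s↔a})` — i.e. `τ_x + τ_y ≤ P(a ∈ C_s | s↔x, s↔y)`.
From `near_sepSum_three` (the three-port separated sum, Harris) and `near_alone_le_allSep` (BHK 1.3). [this work] -/
theorem near_row_XY (w : Sym2 V → unitInterval) (s x y a : V) (hsx : s ≠ x) (hsy : s ≠ y) (hxy : x ≠ y)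
    (hSep : 0 < (prodBernoulli w).real ((openConn s x)ᶜ ∩ (openConn s y)ᶜ ∩ (openConn x y)ᶜ : Set (BondConfig V))) :
    (prodBernoulli w).real (openConn s x ∩ openConn s y : Set (BondConfig V)) *
        ((prodBernoulli w).real ((openConn x s)ᶜ ∩ (openConn x y)ᶜ ∩ openConn x a : Set (BondConfig V)) *
            (prodBernoulli w).real ((openConn y s)ᶜ ∩ (openConn y x)ᶜ : Set (BondConfig V)) +
          (prodBernoulli w).real ((openConn y s)ᶜ ∩ (openConn y x)ᶜ ∩ openConn y a : Set (BondConfig V)) *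
            (prodBernoulli w).real ((openConn x s)ᶜ ∩ (openConn x y)ᶜ : Set (BondConfig V))) ≤
      (prodBernoulli w).real ((openConn x s)ᶜ ∩ (openConn x y)ᶜ : Set (BondConfig V)) *
        (prodBernoulli w).real ((openConn y s)ᶜ ∩ (openConn y x)ᶜ : Set (BondConfig V)) *
        (prodBernoulli w).real (openConn s x ∩ openConn s y ∩ openConn s a : Set (BondConfig V)) := by
  -- the three-port separated sum (Harris) and the two alone-vs-all-separate inequalities (BHK 1.3)
  have hsum := near_sepSum_three w s x y a
  have hx := near_alone_le_allSep w s x y a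
  have hy := near_alone_le_allSep w s y x a
  have eP : ({s, y, x} : Finset V) = {s, x, y} := by
    ext z; simp only [Finset.mem_insert, Finset.mem_singleton]; tauto
  rw [aloneFin_eq hsy (Ne.symm hxy)] at hy
  rw [eP] at hy
  rw [sep_eq hsx hsy hxy, glued_eq] at hsum
  rw [sep_eq hsx hsy hxy, aloneFin_eq hsx hxy] at hx
  rw [sep_eq hsx hsy hxy] at hy
  rw [Finset.sum_insert (by simp [hsx, hsy]), Finset.sum_pair hxy] at hsum
  -- abbreviations
  set S := (prodBernoulli w).real ((openConn s x)ᶜ ∩ (openConn s y)ᶜ ∩ (openConn x y)ᶜ : Set (BondConfig V)) with hS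
  have hSs : 0 ≤ (prodBernoulli w).real ((openConn s x)ᶜ ∩ (openConn s y)ᶜ ∩ (openConn x y)ᶜ ∩ openConn s a : Set (BondConfig V)) :=
    measureReal_nonneg
  have hW : 0 ≤ (prodBernoulli w).real (openConn s x ∩ openConn s y : Set (BondConfig V)) := measureReal_nonneg
  have hDx : 0 ≤ (prodBernoulli w).real ((openConn x s)ᶜ ∩ (openConn x y)ᶜ : Set (BondConfig V)) := measureReal_nonneg
  have hDy : 0 ≤ (prodBernoulli w).real ((openConn y s)ᶜ ∩ (openConn y x)ᶜ : Set (BondConfig V)) := measureReal_nonneg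
  -- hx : μ({x alone} ∩ xa) · S ≤ μ({x alone}) · μ(Sep ∩ xa); hy likewise; hsum : (μ(Sep∩sa) + μ(Sep∩xa) + μ(Sep∩ya))·μ(W) ≤ S·μ(W∩sa)
  -- multiply hsum by μ(Dx)μ(Dy), hx by μ(W)μ(Dy), hy by μ(W)μ(Dx); divide the total by S > 0
  have key : S * ((prodBernoulli w).real (openConn s x ∩ openConn s y : Set (BondConfig V)) *
        ((prodBernoulli w).real ((openConn x s)ᶜ ∩ (openConn x y)ᶜ ∩ openConn x a : Set (BondConfig V)) *
            (prodBernoulli w).real ((openConn y s)ᶜ ∩ (openConn y x)ᶜ : Set (BondConfig V)) +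
          (prodBernoulli w).real ((openConn y s)ᶜ ∩ (openConn y x)ᶜ ∩ openConn y a : Set (BondConfig V)) *
            (prodBernoulli w).real ((openConn x s)ᶜ ∩ (openConn x y)ᶜ : Set (BondConfig V)))) ≤
      S * ((prodBernoulli w).real ((openConn x s)ᶜ ∩ (openConn x y)ᶜ : Set (BondConfig V)) *
        (prodBernoulli w).real ((openConn y s)ᶜ ∩ (openConn y x)ᶜ : Set (BondConfig V)) *
        (prodBernoulli w).real (openConn s x ∩ openConn s y ∩ openConn s a : Set (BondConfig V))) := by
    have h1 := mul_le_mul_of_nonneg_left hsum (mul_nonneg hDx hDy)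
    have h2 := mul_le_mul_of_nonneg_left hx (mul_nonneg hW hDy)
    have h3 := mul_le_mul_of_nonneg_left hy (mul_nonneg hW hDx)
    nlinarith [h1, h2, h3, mul_nonneg (mul_nonneg hDx hDy) (mul_nonneg hSs hW)]
  exact le_of_mul_le_mul_left key hSep

end IncStarTwoCut

end Summit.CriticalPhenomena.PercolationContinuityZ3.Theorems
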